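import Summits.Ventures.QEC.Thresholds.ToricCodePhenomenologicalCluster
import Literature.InformationTheory.QuantumCodes.IIDBitFlip
import HarnessLib

/-!
# The phenomenological toric threshold in the `PMF` vocabulary of row 09
# (`Decoder.logicalFailureProb`, `HasThreshold`)

Venture QEC, `Summits/Ventures/QEC/Thresholds/` (LADDER-QEC Q5; PARTITION row 09 names
`logicalFailureProb`, `HasThreshold`). The twin of the `PMF` section of
`ToricCodeThresholdUnconditional.lean` for the `T`-round memory experiment: the finite-sum failure
probability `phenomFailureProb L T D p p` of `ToricCodePhenomenological.lean` IS the `PMF`-valued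
logical failure probability (`LogicalFailure.lean`) of the space-time decoder `D` for the syndrome
map `stSyn`, the harmless set `stTrivial`, under the product bit-flip law `iidLaw (bitLaw p)` on ALL
space-time links (qubit-error and measurement-error links alike — the isotropic case `q = p`), read
in `ℝ` (`phenomFailureProb_eq_toReal_logicalFailureProb`, from `toReal_iidLaw_bitLaw` of
`IIDBitFlip.lean`, which holds for any finite location type). Consequently every real threshold lower
bound `p₀ ≤ 1` is a `HasThreshold` statement (`phenom_hasThreshold_of_isThresholdLowerBound`), in
particular the UNCONDITIONAL cluster-route value `1/(4·10⁴)` (`phenom_hasThreshold_cluster`,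
`hasThreshold_stMinWeight_cluster`). Theorem-only; kernel axioms. No Monte Carlo number here.

## References

* [DennisEtAl2002] Dennis–Kitaev–Landahl–Preskill, J. Math. Phys. 43 (2002) 4452, §4.2–4.3
  (eq. (ec_cond)), §5.1 eq. (HV_prob).
* [Gottesman2014] D. Gottesman, Quantum Inf. Comput. 14 (2014) 1338, §4 Thm. 4.
-/

noncomputable section

namespace Summit.Ventures.QEC.Thresholds

open Filter Topology Finset
open scoped ENNReal NNReal
open Literature.InformationTheory.QuantumCodes
open Literature.InformationTheory.QuantumCodes.ToricCode

namespace PhenomCluster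

/-- **One number, two vocabularies** (space-time version): the failure probability of the `T`-round
memory experiment at `q = p` equals the `PMF`-valued logical failure probability of the space-time
decoder under independent bit flips of rate `p` on every space-time link, read in `ℝ`.
[cite: DennisEtAl2002, §4.3 eq. (ec_cond) with §5.1 eq. (HV_prob) (p = q)] -/
theorem phenomFailureProb_eq_toReal_logicalFailureProb (L T : ℕ) [NeZero L] (D : STDecoder L T)
    (p : ℝ≥0) (hp : p ≤ 1) :
    phenomFailureProb L T D (p : ℝ) p =
      ((D.logicalFailureProb (stSyn L T) (stTrivial L T) (iidLaw (bitLaw p hp))).toReal) := by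
  classical
  rw [Decoder.logicalFailureProb_eq_sum, ENNReal.toReal_sum (fun e _ => PMF.apply_ne_top _ e),
    phenomFailureProb]
  refine Finset.sum_congr (filter_congr fun e _ => Iff.rfl) fun e _ => ?_
  rw [phenomenologicalWeight_self]
  exact (toReal_iidLaw_bitLaw p hp e).symm

/-- For `0 ≤ p ≤ 1` the `PMF` family of a space-time decoder family, read in `ℝ`, is
`phenomFailureFamily`. [cite: DennisEtAl2002, §4.3 eq. (ec_cond)] -/
theorem toReal_logicalFailureProb_stBitFlip {T : ℕ → ℕ} (D : (L : ℕ) → STDecoder (L + 1) (T L))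
    (L : ℕ) {p : ℝ} (hp₀ : 0 ≤ p) (hp₁ : p ≤ 1) :
    ((D L).logicalFailureProb (stSyn (L + 1) (T L)) (stTrivial (L + 1) (T L))
        (iidLaw (bitLaw (min p.toNNReal 1) (min_le_right _ _)))).toReal =
      phenomFailureFamily T D L p := by
  have hmin : (((min p.toNNReal 1 : ℝ≥0)) : ℝ) = p := by
    rw [min_eq_left (Real.toNNReal_le_one.2 hp₁), Real.coe_toNNReal _ hp₀]
  simp only [phenomFailureFamily]
  rw [← phenomFailureProb_eq_toReal_logicalFailureProb, hmin]

/-- A real threshold lower bound `p₀ ≤ 1` for `phenomFailureFamily T D` is a threshold of the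
`PMF` family in the sense of `HasThreshold`. [cite: DennisEtAl2002, §4.3 (definition of the threshold)] -/
theorem phenom_hasThreshold_of_isThresholdLowerBound {T : ℕ → ℕ}
    {D : (L : ℕ) → STDecoder (L + 1) (T L)} {p₀ : ℝ}
    (h : IsThresholdLowerBound (phenomFailureFamily T D) p₀) (hp₀ : p₀ ≤ 1) :
    HasThreshold (fun L p => (D L).logicalFailureProb (stSyn (L + 1) (T L)) (stTrivial (L + 1) (T L))
      (iidLaw (bitLaw (min p.toNNReal 1) (min_le_right _ _)))) p₀ := by
  refine (hasThreshold_iff_isThresholdLowerBound_toReal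
    (P := fun L p => (D L).logicalFailureProb (stSyn (L + 1) (T L)) (stTrivial (L + 1) (T L))
      (iidLaw (bitLaw (min p.toNNReal 1) (min_le_right _ _))))
    (fun L p => ne_top_of_le_ne_top ENNReal.one_ne_top (Decoder.logicalFailureProb_le_one _ _ _ _))
    p₀).2 ?_
  intro p hp hpp
  have h1 : p ≤ 1 := hpp.le.trans hp₀
  exact (h p hp hpp).congr fun L => (toReal_logicalFailureProb_stBitFlip D L hp h1).symm

/-- **Row-09 headline, phenomenological model, in the PARTITION's vocabulary** — UNCONDITIONAL: for
every polynomially bounded schedule of rounds and every minimum-weight space-time decoder family, the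
logical failure probability of the `T(L)`-round toric memory experiment under i.i.d. faults of rate
`p` on qubits AND syndrome bits tends to `0` as `L → ∞`, for every `0 ≤ p < 1/(4·10⁴)`. tier CERTIFIED
(kernel), no named fact. [cite: Gottesman2014, Thm 4] -/
theorem phenom_hasThreshold_cluster {T : ℕ → ℕ} (hT : IsPolyBounded T)
    {D : (L : ℕ) → STDecoder (L + 1) (T L)}
    (hD : ∀ L, (D L).IsMinWeight (stSyn (L + 1) (T L)) (stCycles (L + 1) (T L)) hammingNorm) :
    HasThreshold (fun L p => (D L).logicalFailureProb (stSyn (L + 1) (T L)) (stTrivial (L + 1) (T L))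
      (iidLaw (bitLaw (min p.toNNReal 1) (min_le_right _ _)))) (1 / (4 * (10 : ℝ) ^ 4)) :=
  phenom_hasThreshold_of_isThresholdLowerBound (phenomThreshold_cluster hT hD) (by norm_num)

/-- The canonical instance in the `PMF` vocabulary: `T(L) = L + 1` rounds, canonical minimum-weight
space-time decoders, `HasThreshold` at `1/(4·10⁴)` — unconditional. [cite: Gottesman2014, Thm 4] -/
theorem hasThreshold_stMinWeight_cluster :
    HasThreshold (fun L p =>
      (Decoder.minWeight (stSyn (L + 1) (L + 1)) hammingNorm).logicalFailureProb
        (stSyn (L + 1) (L + 1)) (stTrivial (L + 1) (L + 1))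
        (iidLaw (bitLaw (min p.toNNReal 1) (min_le_right _ _)))) (1 / (4 * (10 : ℝ) ^ 4)) :=
  phenom_hasThreshold_cluster (T := fun L => L + 1) isPolyBounded_succ
    fun L => ToricCode.isMinWeight_stMinWeight (L + 1) (L + 1)

end PhenomCluster

end Summit.Ventures.QEC.Thresholds

end
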